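import Literature.AlgebraicGeometry.Frobenioids.PadicFrobenioidBaseGaloisSystemRelCoset
import Literature.AlgebraicGeometry.Frobenioids.PadicFrobenioidPairIsoTopological
import HarnessLib

/-!
# `Ψ^Base = θ_*`: an equivalence of the small bases `𝓑^temp(Π₁, Π₁°)⁰ ≌ 𝓑^temp(Π₂, Π₂°)⁰` is push-forward along an
# isomorphism of TOPOLOGICAL groups `θ : Π₁ ⥲ Π₂`, naturally ([FrdII] Thm. 2.4, base step; [SemiAnbd] Prop. 3.2)

Mochizuki, *The geometry of Frobenioids II*, Kyushu J. Math. **62** (2008) 401–460, §2, Theorem 2.4, p. 19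
[cite: MochizukiFrdII2008, Thm 2.4 (i) p.19]: "an equivalence of categories `Ψ : C₁ ⥲ C₂` — which … necessarily induces
a 1-compatible equivalence of categories `Ψ_Base : D₁ ⥲ D₂`, hence an outer isomorphism of topological groups
`Π₁ ⥲ Π₂` [cf. [Mzk2], Proposition 3.2] …", where `Dᵢ = 𝓑^temp(Πᵢ, Πᵢ°)⁰` ([FrdII] Ex. 1.3 (i); the tree's small model
is `RelCosetCat Πᵢ°`, `RelCosetCategories.lean`).  Mochizuki, *Semi-graphs of anabelioids*, Publ. RIMS **42** (2006),
Remark 3.2.1 p. 35 [cite: MochizukiSemiAnbd2006, Rmk 3.2.1 p.35]: "`π₁^temp(X)` … well-defined, up to inner automorphism".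

PROOF-ONLY companion (plus auxiliary constructions, no `Prop`-valued definition) of abc-iut-w5-d194's
`PadicFrobenioidBaseGaloisSystemRelCoset.lean`, which supplies from `E : RelCosetCat Π₁° ≌ RelCosetCat Π₂°` (tempered,
Galois-countable `Πᵢ`) a straightening `ι` of the image of the Galois pro-system `k ↦ Π₁/N_k` and an ABSTRACT
`φ : Π₁ ≃* Π₂` with `r_{φ g} = ι⁻¹ ∘ E(r_g) ∘ ι` on the Galois objects (`exists_mulEquiv_compatible_of_relCosetCat_equivalence`).
This file adds what [FrdII] Thm. 2.4 actually consumes (cell abc-iut, seat abc-iut-L1-t7: the structural input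
{`θ`, `e`, `compat`} of `PadicKummerThm24iFrobenioidRelTheta.lean`):

* §1 `crightMul_straighten` — the level-`k` form of the compatibility: `r_{φ g} ≫ ι_k = ι_k ≫ E(r_g)`;
* §2 `apply_mem_iff` — `φ g ∈ N₂,k ↔ g ∈ N₁,k` (faithfulness of `E`), whence `φ` and `φ⁻¹` are CONTINUOUS
  (`continuous_mulEquiv_and_symm`, through abc-iut-L1's `continuous_of_levelwise` of `PadicFrobenioidPairIsoTopological`):
  `toContinuousMulEquiv : Π₁ ≃ₜ* Π₂` — the isomorphism of TOPOLOGICAL groups of print (the `CosetCat` twin of this step,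
  objects up to conjugacy, is `CosetBaseEquivalenceObjects.lean`; new here: the RELATIVE base and, in the sequel, NATURALITY);
* §3 `basePt X ∈ E(X)` — the image of `1·N₂,k` under `ι_k ≫ E(Π₁/N_k ↠ Π₁/U)` (`X = Π₁/U`, `N_k ⊆ U`), independent of
  the level (`pt_cmp_eq`), with stabiliser EXACTLY `φ(U)` (`smul_basePt_eq_iff`);
* the sequel `PadicFrobenioidBaseGaloisSystemPushIso.lean` assembles `φ_*(Π₁/U) = Π₂/φ(U) ≅ E(Π₁/U)` into the NATURAL
  isomorphism `RelCosetCat.incl Π₁° ⋙ CosetCat.push φ ≅ E.functor ⋙ RelCosetCat.incl Π₂°` ("`Ψ_Base = φ_*` 1-compatibly") and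
  the packaged existence statements.

Classical Galois-category bookkeeping (SGA 1 V §4; [SemiAnbd] Prop. 3.2 for EQUIVALENCES of CONNECTED parts, which is the
form [FrdII] uses) over landed files; nothing here bears on [IUTchIII] Cor. 3.12; no statement of either paper is
strengthened.
-/

noncomputable section

namespace Literature.AlgebraicGeometry.Frobenioids

open CategoryTheory Opposite Topology Filter
open Literature.AnabelianGeometry.SemiGraphs

universe u

namespace BaseGaloisSystem

variable {G : Type u} [Group G] [TopologicalSpace G]

/-! ### §0 Plumbing in the small coset category -/

/-- The projection `Π/N ↠ Π/U` (`N ⊆ U`): `gN ↦ gU`. [cite: MochizukiFrdII2008, Ex 1.3 (i) p.11] -/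
def cprojTo (N : OpenNormalSubgroup G) (X : CosetCat G) (h : N.toOpenSubgroup ≤ X.sg) : cQ N ⟶ X :=
  CosetCat.homMk ((1 : G) : X.carrier) fun u hu => (CosetCat.smul_one_eq_one_iff X u).mpr (h hu)

/-- `pt (Π/N ↠ Π/U) = 1·U`. [cite: MochizukiFrdII2008, Ex 1.3 (i) p.11] -/
@[simp] theorem pt_cprojTo (N : OpenNormalSubgroup G) (X : CosetCat G) (h : N.toOpenSubgroup ≤ X.sg) :
    CosetCat.pt (cprojTo N X h) = ((1 : G) : X.carrier) :=
  CosetCat.pt_homMk _ _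

/-- `pt (r_g ≫ f) = g · pt f` for `f` out of a Galois object `Π/N`. [cite: MochizukiFrdII2008, Ex 1.3 (i) p.11] -/
theorem pt_crightMul_comp (N : OpenNormalSubgroup G) (g : G) {Y : CosetCat G} (f : cQ N ⟶ Y) :
    CosetCat.pt (crightMul N g ≫ f) = g • CosetCat.pt f := by
  rw [CosetCat.pt_comp, pt_crightMul, CosetCat.toFun_coe]

/-- Two projections compose: `Π/N ↠ Π/M ↠ Π/U = Π/N ↠ Π/U`. [cite: MochizukiFrdII2008, Ex 1.3 (i) p.11] -/
theorem cproj_comp_cprojTo {N M : OpenNormalSubgroup G} (hNM : N ≤ M) (X : CosetCat G) (h : M.toOpenSubgroup ≤ X.sg) :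
    cproj hNM ≫ cprojTo M X h = cprojTo N X (fun _ hx => h (hNM hx)) :=
  CosetCat.hom_ext (by
    rw [CosetCat.pt_comp, pt_cproj, CosetCat.toFun_coe, one_smul, pt_cprojTo, pt_cprojTo])

/-- `r_g ≫ (Π/N ↠ Π/U) = (Π/N ↠ Π/U)` iff `g ∈ U`. [cite: MochizukiFrdII2008, Ex 1.3 (i) p.11] -/
theorem crightMul_comp_cprojTo_eq_iff (N : OpenNormalSubgroup G) (X : CosetCat G) (h : N.toOpenSubgroup ≤ X.sg) (g : G) :
    crightMul N g ≫ cprojTo N X h = cprojTo N X h ↔ g ∈ X.sg := by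
  rw [← CosetCat.smul_one_eq_one_iff X g]
  constructor
  · intro he
    have h' := congrArg CosetCat.pt he
    rwa [pt_crightMul_comp, pt_cprojTo] at h'
  · intro hg
    exact CosetCat.hom_ext (by rw [pt_crightMul_comp, pt_cprojTo, hg])

/-- A morphism `h : Π/U → Π/U'` with `pt h = a·U'` factors the projections: `(Π/N ↠ Π/U) ≫ h = r_a ≫ (Π/N ↠ Π/U')`.
[cite: MochizukiFrdII2008, Ex 1.3 (i) p.11] -/
theorem cprojTo_comp_eq (N : OpenNormalSubgroup G) {X X' : CosetCat G} (h : N.toOpenSubgroup ≤ X.sg)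
    (h' : N.toOpenSubgroup ≤ X'.sg) (f : X ⟶ X') (a : G) (ha : CosetCat.pt f = ((a : G) : X'.carrier)) :
    cprojTo N X h ≫ f = crightMul N a ≫ cprojTo N X' h' :=
  CosetCat.hom_ext (by
    rw [CosetCat.pt_comp, pt_cprojTo, pt_crightMul_comp, pt_cprojTo, MulAction.Quotient.smul_coe, smul_eq_mul, mul_one]
    exact ha)

/-! ### §1 The straightened equivalence: `r_{φ g} ≫ ι_k = ι_k ≫ E(r_g)` -/

section Straightened

variable (hG : IsTempered G) (H : OpenSubgroup G)
  {G₂ : Type u} [Group G₂] [TopologicalSpace G₂] (hG₂ : IsTempered G₂) (H₂ : OpenSubgroup G₂)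
  (E : RelCosetCat H ≌ RelCosetCat H₂)
  (N : ℕ → OpenNormalSubgroup G) (hN : Antitone N) (hNH : ∀ k, (N k).toOpenSubgroup ≤ H)
  (hNb : ∀ U ∈ 𝓝 (1 : G), ∃ k, (N k : Set G) ⊆ U)
  (N₂ : ℕ → OpenNormalSubgroup G₂) (hN₂ : Antitone N₂) (hNH₂ : ∀ k, (N₂ k).toOpenSubgroup ≤ H₂)
  (hN₂b : ∀ U ∈ 𝓝 (1 : G₂), ∃ k, (N₂ k : Set G₂) ⊆ U)
  (ι : relCosetSystem H N hN hNH ⋙ E.functor.op ≅ relCosetSystem H₂ N₂ hN₂ hNH₂) (φ : G ≃* G₂)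
  (hφ : ∀ g : G, toAutRelCosetMulEquiv H₂ N₂ hN₂ hNH₂ hG₂ hN₂b (φ g) =
    ι.conjAut ((Equivalence.congrRight (E := ℕ) E.op).functor.mapIso (toAutRelCosetMulEquiv H N hN hNH hG hNb g)))

/-- The straightening isomorphism at level `k`: `ι_k : Π₂/N₂,k ⥲ E(Π₁/N_k)`. [cite: MochizukiFrdII2008, Thm 2.4 (ii) p.21] -/
abbrev strIso (k : ℕ) : rQ H₂ (N₂ k) (hNH₂ k) ≅ E.functor.obj (rQ H (N k) (hNH k)) :=
  (ι.app k).unop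

include hφ in
/-- **Level-`k` compatibility**: right translation by `φ g` on `Π₂/N₂,k` corresponds under `ι_k` to `E(r_g)`:
`r_{φ g} ≫ ι_k = ι_k ≫ E(r_g)`. [cite: MochizukiFrdII2008, Thm 2.4 (ii) p.21] -/
theorem crightMul_straighten (g : G) (k : ℕ) :
    (ObjectProperty.homMk (crightMul (N₂ k) (φ g)) : rQ H₂ (N₂ k) (hNH₂ k) ⟶ rQ H₂ (N₂ k) (hNH₂ k)) ≫
        (strIso H H₂ E N hN hNH N₂ hN₂ hNH₂ ι k).hom =
      (strIso H H₂ E N hN hNH N₂ hN₂ hNH₂ ι k).hom ≫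
        E.functor.map (ObjectProperty.homMk (crightMul (N k) g)) := by
  have h := congrArg (fun α : Aut (relCosetSystem H₂ N₂ hN₂ hNH₂) => (α.hom.app k).unop) (hφ g)
  have h1 : ((toAutRelCosetMulEquiv H₂ N₂ hN₂ hNH₂ hG₂ hN₂b (φ g)).hom.app k).unop =
      (ObjectProperty.homMk (crightMul (N₂ k) (φ g)) : rQ H₂ (N₂ k) (hNH₂ k) ⟶ rQ H₂ (N₂ k) (hNH₂ k)) :=
    ObjectProperty.hom_ext _ (toAutRelCosetMulEquiv_hom_app H₂ N₂ hN₂ hNH₂ hG₂ hN₂b (φ g) k)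
  have h2 : ((toAutRelCosetMulEquiv H N hN hNH hG hNb g).hom.app k).unop =
      (ObjectProperty.homMk (crightMul (N k) g) : rQ H (N k) (hNH k) ⟶ rQ H (N k) (hNH k)) :=
    ObjectProperty.hom_ext _ (toAutRelCosetMulEquiv_hom_app H N hN hNH hG hNb g k)
  rw [h1, Iso.conjAut_hom, Iso.conj_apply, NatTrans.comp_app, NatTrans.comp_app, unop_comp, unop_comp] at h
  -- `h : homMk r₂ = (ι.hom.app k).unop ≫ (σ.hom.app k).unop ≫ (ι.inv.app k).unop`
  have h3 : ((((Equivalence.congrRight (E := ℕ) E.op).functor.mapIso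
      (toAutRelCosetMulEquiv H N hN hNH hG hNb g)).hom.app k).unop) =
      E.functor.map (ObjectProperty.homMk (crightMul (N k) g)) :=
    (show _ = E.functor.map (((toAutRelCosetMulEquiv H N hN hNH hG hNb g).hom.app k).unop) from rfl).trans
      (congrArg E.functor.map h2)
  have h' : (ObjectProperty.homMk (crightMul (N₂ k) (φ g)) : rQ H₂ (N₂ k) (hNH₂ k) ⟶ rQ H₂ (N₂ k) (hNH₂ k)) =
      ((strIso H H₂ E N hN hNH N₂ hN₂ hNH₂ ι k).hom ≫ E.functor.map (ObjectProperty.homMk (crightMul (N k) g))) ≫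
        (ι.inv.app k).unop :=
    h.trans (congrArg (fun t => ((strIso H H₂ E N hN hNH N₂ hN₂ hNH₂ ι k).hom ≫ t) ≫ (ι.inv.app k).unop) h3)
  have h4 : (ι.inv.app k).unop ≫ (strIso H H₂ E N hN hNH N₂ hN₂ hNH₂ ι k).hom = 𝟙 _ := by
    change (ι.inv.app k).unop ≫ (ι.hom.app k).unop = 𝟙 _
    rw [← unop_comp, Iso.hom_inv_id_app]
    rfl
  rw [h']
  exact (Category.assoc _ _ _).trans ((congrArg (fun t => ((strIso H H₂ E N hN hNH N₂ hN₂ hNH₂ ι k).hom ≫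
    E.functor.map (ObjectProperty.homMk (crightMul (N k) g))) ≫ t) h4).trans (Category.comp_id _))

/-! ### §2 `φ(N₁,k) = N₂,k`: the abstract isomorphism is a homeomorphism -/

include hφ in
/-- **`φ g ∈ N₂,k ↔ g ∈ N₁,k`**: `r_{φ g} = 1` on `Π₂/N₂,k` iff `E(r_g) = 1` iff (faithfulness) `r_g = 1` on `Π₁/N_k`.
[cite: MochizukiSemiAnbd2006, Rmk 3.2.1 p.35] -/
theorem apply_mem_iff (g : G) (k : ℕ) : φ g ∈ N₂ k ↔ g ∈ N k := by
  have key := crightMul_straighten hG H hG₂ H₂ E N hN hNH hNb N₂ hN₂ hNH₂ hN₂b ι φ hφ g k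
  constructor
  · intro hg
    have h1 : (ObjectProperty.homMk (crightMul (N₂ k) (φ g)) : rQ H₂ (N₂ k) (hNH₂ k) ⟶ rQ H₂ (N₂ k) (hNH₂ k)) = 𝟙 _ :=
      ObjectProperty.hom_ext _ ((mem_iff_crightMul_eq_id (N₂ k) (φ g)).mp hg)
    rw [h1, Category.id_comp] at key
    have h2 : E.functor.map (ObjectProperty.homMk (crightMul (N k) g) : rQ H (N k) (hNH k) ⟶ rQ H (N k) (hNH k)) =
        E.functor.map (𝟙 _) := by
      rw [E.functor.map_id]
      exact ((cancel_epi (strIso H H₂ E N hN hNH N₂ hN₂ hNH₂ ι k).hom).mp (key.symm.trans (Category.comp_id _).symm))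
    have h3 := congrArg InducedCategory.Hom.hom (E.functor.map_injective h2)
    exact (mem_iff_crightMul_eq_id (N k) g).mpr h3
  · intro hg
    have h1 : (ObjectProperty.homMk (crightMul (N k) g) : rQ H (N k) (hNH k) ⟶ rQ H (N k) (hNH k)) = 𝟙 _ :=
      ObjectProperty.hom_ext _ ((mem_iff_crightMul_eq_id (N k) g).mp hg)
    rw [h1, E.functor.map_id, Category.comp_id] at key
    have h2 : (ObjectProperty.homMk (crightMul (N₂ k) (φ g)) : rQ H₂ (N₂ k) (hNH₂ k) ⟶ rQ H₂ (N₂ k) (hNH₂ k)) = 𝟙 _ :=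
      (cancel_mono (strIso H H₂ E N hN hNH N₂ hN₂ hNH₂ ι k).hom).mp (key.trans (Category.id_comp _).symm)
    have h3 := congrArg InducedCategory.Hom.hom h2
    exact (mem_iff_crightMul_eq_id (N₂ k) (φ g)).mpr h3

include hφ in
/-- `φ⁻¹ y ∈ N₁,k ↔ y ∈ N₂,k`. [cite: MochizukiSemiAnbd2006, Rmk 3.2.1 p.35] -/
theorem symm_apply_mem_iff (y : G₂) (k : ℕ) : φ.symm y ∈ N k ↔ y ∈ N₂ k := by
  rw [← apply_mem_iff hG H hG₂ H₂ E N hN hNH hNb N₂ hN₂ hNH₂ hN₂b ι φ hφ (φ.symm y) k, MulEquiv.apply_symm_apply]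

include hφ in
/-- **`φ` and `φ⁻¹` are continuous**: the straightened systems `N₁,•`, `N₂,•` are neighbourhood bases of `1` and
`φ(N₁,k) = N₂,k` (abc-iut-L1's `continuous_of_levelwise`, consumed by name). [cite: MochizukiFrdII2008, Thm 2.4 (i) p.19] -/
theorem continuous_mulEquiv_and_symm [IsTopologicalGroup G] [IsTopologicalGroup G₂] : Continuous φ ∧ Continuous φ.symm :=
  continuous_of_levelwise N N₂ φ hNb hN₂b fun k g =>
    (apply_mem_iff hG H hG₂ H₂ E N hN hNH hNb N₂ hN₂ hNH₂ hN₂b ι φ hφ g k).symm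

/-- **The isomorphism of TOPOLOGICAL groups `Π₁ ⥲ Π₂` induced by `Ψ_Base`** ("hence an outer isomorphism of topological
groups `Π₁ ⥲ Π₂`"): w5-d194's abstract `φ` with its continuity and the continuity of its inverse.
[cite: MochizukiFrdII2008, Thm 2.4 (i) p.19] -/
def toContinuousMulEquiv [IsTopologicalGroup G] [IsTopologicalGroup G₂] : G ≃ₜ* G₂ where
  toMulEquiv := φ
  continuous_toFun := (continuous_mulEquiv_and_symm hG H hG₂ H₂ E N hN hNH hNb N₂ hN₂ hNH₂ hN₂b ι φ hφ).1
  continuous_invFun := (continuous_mulEquiv_and_symm hG H hG₂ H₂ E N hN hNH hNb N₂ hN₂ hNH₂ hN₂b ι φ hφ).2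

/-- `toContinuousMulEquiv` is `φ` on elements. [cite: MochizukiFrdII2008, Thm 2.4 (i) p.19] -/
@[simp] theorem toContinuousMulEquiv_apply [IsTopologicalGroup G] [IsTopologicalGroup G₂] (g : G) :
    toContinuousMulEquiv hG H hG₂ H₂ E N hN hNH hNb N₂ hN₂ hNH₂ hN₂b ι φ hφ g = φ g := rfl

include hφ in
/-- `φ` is an open map. [cite: MochizukiFrdII2008, Thm 2.4 (i) p.19] -/
theorem isOpenMap_mulEquiv [IsTopologicalGroup G] [IsTopologicalGroup G₂] : IsOpenMap φ.toMonoidHom :=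
  (toContinuousMulEquiv hG H hG₂ H₂ E N hN hNH hNb N₂ hN₂ hNH₂ hN₂b ι φ hφ).toHomeomorph.isOpenMap

/-! ### §3 Base points: the image of `1·N₂,k` in `E(Π₁/U)` and its stabiliser `φ(U)` -/

omit hN in
include hNb in
/-- Every `Π₁/U` is dominated by some `Π₁/N_k` (`N_k ⊆ U`, cofinality). [cite: MochizukiFrdII2008, Thm 2.4 (ii) p.20] -/
theorem exists_level (X : CosetCat G) : ∃ k, (N k).toOpenSubgroup ≤ X.sg := by
  obtain ⟨k, hk⟩ := hNb _ X.sg.mem_nhds_one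
  exact ⟨k, fun x hx => hk hx⟩

/-- A level `k` with `N_k ⊆ U`, chosen. [cite: MochizukiFrdII2008, Thm 2.4 (ii) p.20] -/
def lvl (X : RelCosetCat H) : ℕ := Classical.choose (exists_level N hNb X.obj)

/-- `N_{lvl X} ⊆ U`. [cite: MochizukiFrdII2008, Thm 2.4 (ii) p.20] -/
theorem lvl_le (X : RelCosetCat H) : (N (lvl H N hNb X)).toOpenSubgroup ≤ X.obj.sg :=
  Classical.choose_spec (exists_level N hNb X.obj)

/-- **The comparison morphism** `Π₂/N₂,k ⥲ E(Π₁/N_k) → E(Π₁/U)` at a level `k` with `N_k ⊆ U`.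
[cite: MochizukiFrdII2008, Thm 2.4 (i) p.19] -/
def cmp (X : RelCosetCat H) (k : ℕ) (hk : (N k).toOpenSubgroup ≤ X.obj.sg) : rQ H₂ (N₂ k) (hNH₂ k) ⟶ E.functor.obj X :=
  (strIso H H₂ E N hN hNH N₂ hN₂ hNH₂ ι k).hom ≫ E.functor.map (ObjectProperty.homMk (cprojTo (N k) X.obj hk))

/-- Naturality of the straightening along the projections: `ι_j ≫ E(Π₁/N_j ↠ Π₁/N_k) = (Π₂/N₂,j ↠ Π₂/N₂,k) ≫ ι_k`.
[cite: MochizukiFrdII2008, Thm 2.4 (ii) p.21] -/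
theorem strIso_hom_comp_map_cproj {k j : ℕ} (hkj : k ≤ j) :
    (strIso H H₂ E N hN hNH N₂ hN₂ hNH₂ ι j).hom ≫
        E.functor.map (ObjectProperty.homMk (cproj (hN hkj)) : rQ H (N j) (hNH j) ⟶ rQ H (N k) (hNH k)) =
      (ObjectProperty.homMk (cproj (hN₂ hkj)) : rQ H₂ (N₂ j) (hNH₂ j) ⟶ rQ H₂ (N₂ k) (hNH₂ k)) ≫
        (strIso H H₂ E N hN hNH N₂ hN₂ hNH₂ ι k).hom := by
  have h := congrArg Quiver.Hom.unop (ι.hom.naturality (homOfLE hkj))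
  rw [unop_comp, unop_comp] at h
  exact h

/-- The comparison morphisms are compatible with the projections: `(Π₂/N₂,j ↠ Π₂/N₂,k) ≫ cmp_k = cmp_j`.
[cite: MochizukiFrdII2008, Thm 2.4 (i) p.19] -/
theorem cproj_comp_cmp (X : RelCosetCat H) {k j : ℕ} (hkj : k ≤ j) (hk : (N k).toOpenSubgroup ≤ X.obj.sg)
    (hj : (N j).toOpenSubgroup ≤ X.obj.sg) :
    (ObjectProperty.homMk (cproj (hN₂ hkj)) : rQ H₂ (N₂ j) (hNH₂ j) ⟶ rQ H₂ (N₂ k) (hNH₂ k)) ≫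
        cmp H H₂ E N hN hNH N₂ hN₂ hNH₂ ι X k hk = cmp H H₂ E N hN hNH N₂ hN₂ hNH₂ ι X j hj := by
  have hfac : (ObjectProperty.homMk (cprojTo (N j) X.obj hj) : rQ H (N j) (hNH j) ⟶ X) =
      (ObjectProperty.homMk (cproj (hN hkj)) : rQ H (N j) (hNH j) ⟶ rQ H (N k) (hNH k)) ≫
        ObjectProperty.homMk (cprojTo (N k) X.obj hk) :=
    ObjectProperty.hom_ext _ (cproj_comp_cprojTo (hN hkj) X.obj hk).symm
  rw [cmp, cmp, hfac, Functor.map_comp, ← Category.assoc ((strIso H H₂ E N hN hNH N₂ hN₂ hNH₂ ι j).hom),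
    strIso_hom_comp_map_cproj H H₂ E N hN hNH N₂ hN₂ hNH₂ ι hkj, Category.assoc]

/-- **Level independence** of the point of the comparison morphism. [cite: MochizukiFrdII2008, Thm 2.4 (i) p.19] -/
theorem pt_cmp_eq (X : RelCosetCat H) {k j : ℕ} (hk : (N k).toOpenSubgroup ≤ X.obj.sg)
    (hj : (N j).toOpenSubgroup ≤ X.obj.sg) :
    CosetCat.pt (cmp H H₂ E N hN hNH N₂ hN₂ hNH₂ ι X k hk).hom = CosetCat.pt (cmp H H₂ E N hN hNH N₂ hN₂ hNH₂ ι X j hj).hom := by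
  -- through the common refinement `max k j`
  have hm : (N (max k j)).toOpenSubgroup ≤ X.obj.sg := fun x hx => hk (hN (le_max_left k j) hx)
  have step : ∀ {i : ℕ} (hi : (N i).toOpenSubgroup ≤ X.obj.sg) (him : i ≤ max k j),
      CosetCat.pt (cmp H H₂ E N hN hNH N₂ hN₂ hNH₂ ι X i hi).hom =
        CosetCat.pt (cmp H H₂ E N hN hNH N₂ hN₂ hNH₂ ι X (max k j) hm).hom := by
    intro i hi him
    rw [← cproj_comp_cmp H H₂ E N hN hNH N₂ hN₂ hNH₂ ι X him hi hm, ObjectProperty.FullSubcategory.comp_hom,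
      ObjectProperty.homMk_hom, CosetCat.pt_comp, pt_cproj]
    rfl
  rw [step hk (le_max_left k j), step hj (le_max_right k j)]

/-- **The base point** `y_X ∈ E(Π₁/U)`: the image of `1·N₂,k` under `Π₂/N₂,k ⥲ E(Π₁/N_k) → E(Π₁/U)`.
[cite: MochizukiFrdII2008, Thm 2.4 (i) p.19] -/
def basePt (X : RelCosetCat H) : (E.functor.obj X).obj.carrier :=
  CosetCat.pt (cmp H H₂ E N hN hNH N₂ hN₂ hNH₂ ι X (lvl H N hNb X) (lvl_le H N hNb X)).hom

/-- The base point may be computed at any level. [cite: MochizukiFrdII2008, Thm 2.4 (i) p.19] -/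
theorem basePt_eq (X : RelCosetCat H) (k : ℕ) (hk : (N k).toOpenSubgroup ≤ X.obj.sg) :
    basePt H H₂ E N hN hNH hNb N₂ hN₂ hNH₂ ι X = CosetCat.pt (cmp H H₂ E N hN hNH N₂ hN₂ hNH₂ ι X k hk).hom :=
  pt_cmp_eq H H₂ E N hN hNH N₂ hN₂ hNH₂ ι X _ hk

include hφ in
/-- **Translating the base point**: `φ g · y_X` is the point of `ι_k ≫ E(r_g ≫ (Π₁/N_k ↠ Π₁/U))`.
[cite: MochizukiFrdII2008, Thm 2.4 (i) p.19] -/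
theorem smul_pt_cmp (X : RelCosetCat H) (k : ℕ) (hk : (N k).toOpenSubgroup ≤ X.obj.sg) (g : G) :
    φ g • CosetCat.pt (cmp H H₂ E N hN hNH N₂ hN₂ hNH₂ ι X k hk).hom =
      CosetCat.pt ((strIso H H₂ E N hN hNH N₂ hN₂ hNH₂ ι k).hom ≫
        E.functor.map (ObjectProperty.homMk (crightMul (N k) g ≫ cprojTo (N k) X.obj hk) :
          rQ H (N k) (hNH k) ⟶ X)).hom := by
  have hfac : (ObjectProperty.homMk (crightMul (N k) g ≫ cprojTo (N k) X.obj hk) : rQ H (N k) (hNH k) ⟶ X) =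
      (ObjectProperty.homMk (crightMul (N k) g) : rQ H (N k) (hNH k) ⟶ rQ H (N k) (hNH k)) ≫
        ObjectProperty.homMk (cprojTo (N k) X.obj hk) := rfl
  rw [hfac, Functor.map_comp, ← Category.assoc,
    ← crightMul_straighten hG H hG₂ H₂ E N hN hNH hNb N₂ hN₂ hNH₂ hN₂b ι φ hφ g k, Category.assoc,
    ObjectProperty.FullSubcategory.comp_hom, ObjectProperty.homMk_hom, pt_crightMul_comp]
  rfl

include hφ in
/-- **The stabiliser of the base point is exactly `φ(U)`**: `φ g · y_X = y_X ↔ g ∈ U` — "⇐" since `r_g ≫ (Π₁/N_k ↠ Π₁/U)`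
does not see `g ∈ U`, "⇒" by FAITHFULNESS of `E`. [cite: MochizukiFrdII2008, Thm 2.4 (i) p.19] -/
theorem smul_basePt_eq_iff (X : RelCosetCat H) (g : G) :
    φ g • basePt H H₂ E N hN hNH hNb N₂ hN₂ hNH₂ ι X = basePt H H₂ E N hN hNH hNb N₂ hN₂ hNH₂ ι X ↔ g ∈ X.obj.sg := by
  set k := lvl H N hNb X with hkdef
  have hk : (N k).toOpenSubgroup ≤ X.obj.sg := lvl_le H N hNb X
  rw [basePt_eq H H₂ E N hN hNH hNb N₂ hN₂ hNH₂ ι X k hk, smul_pt_cmp hG H hG₂ H₂ E N hN hNH hNb N₂ hN₂ hNH₂ hN₂b ι φ hφ X k hk g]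
  constructor
  · intro h
    -- equal points ⇒ equal morphisms out of `Π₂/N₂,k` ⇒ (cancel `ι_k`, faithfulness) `r_g ≫ q = q`
    have h1 : (strIso H H₂ E N hN hNH N₂ hN₂ hNH₂ ι k).hom ≫
        E.functor.map (ObjectProperty.homMk (crightMul (N k) g ≫ cprojTo (N k) X.obj hk) : rQ H (N k) (hNH k) ⟶ X) =
        cmp H H₂ E N hN hNH N₂ hN₂ hNH₂ ι X k hk :=
      ObjectProperty.hom_ext _ (CosetCat.hom_ext h)
    have h2 := E.functor.map_injective ((cancel_epi (strIso H H₂ E N hN hNH N₂ hN₂ hNH₂ ι k).hom).mp h1)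
    have h3 : crightMul (N k) g ≫ cprojTo (N k) X.obj hk = cprojTo (N k) X.obj hk := congrArg InducedCategory.Hom.hom h2
    exact (crightMul_comp_cprojTo_eq_iff (N k) X.obj hk g).mp h3
  · intro hg
    rw [(crightMul_comp_cprojTo_eq_iff (N k) X.obj hk g).mpr hg]
    rfl

include hφ in
/-- Stabiliser of the base point, for elements of `Π₂`: `y · y_X = y_X ↔ φ⁻¹ y ∈ U`. [cite: MochizukiFrdII2008, Thm 2.4 (i) p.19] -/
theorem smul_basePt_eq_iff' (X : RelCosetCat H) (y : G₂) :
    y • basePt H H₂ E N hN hNH hNb N₂ hN₂ hNH₂ ι X = basePt H H₂ E N hN hNH hNb N₂ hN₂ hNH₂ ι X ↔ φ.symm y ∈ X.obj.sg := by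
  rw [← smul_basePt_eq_iff hG H hG₂ H₂ E N hN hNH hNb N₂ hN₂ hNH₂ hN₂b ι φ hφ X (φ.symm y), MulEquiv.apply_symm_apply]

end Straightened

end BaseGaloisSystem

end Literature.AlgebraicGeometry.Frobenioids

end
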